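import Summits.FinalStateConjecture.FinalStateConjecture.Theorems.PhotonSphereChannelsDarkFutureDefs
import Literature.Geometry.Lorentzian.Isometry
import Literature.Geometry.Lorentzian.KerrData
import HarnessLib

/-!
# Route PhotonSphereChannels · crux `ChannelsResolveTameDevelopmentsR` · line `dark-future-exactness`
# Glue G4: a time-oriented local isometry of the smooth Kerr exterior onto `O` is a Kerr d.o.c. chart

The conclusion shape of the eternal-stationary-exterior rigidity statement (an injective local
isometry `Ψ` of `(Kerr.exterior M a, Kerr.smoothMetric M a r₊)` into `𝓢` with image `O`) together
with the black-hole orientation clause (`Ψ_* ∂_{t*}` future-directed where `r > 2M`) is exactly the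
line's `TameHull.IsKerrDoc 𝓢 O M a`: the pullback identity `Ψ^* g = g_{M,a}` of
`PseudoRiemannianMetric.IsLocalIsometry` is, fibrewise, the vanishing of the metric deviation
`Spacetime.deviation (Kerr.background M a) Ψ x = Ψ^* g (x) − Kerr.bilin M a x = 0`, because the value
of `Kerr.smoothMetric M a r₊` at `x` is the Kerr–Schild form `Kerr.bilin M a x` (`Kerr.smoothMetric_val`,
by `rfl`) and the background form of `Kerr.background M a` is `Kerr.bilin M a` (by `rfl`); smoothness
of `Ψ` is that of a local diffeomorphism (`IsLocalDiffeomorph.contMDiff`).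
-/

noncomputable section

-- the operator-norm instance on `E4 →L[ℝ] E4 →L[ℝ] ℝ` needs one more level of pending
-- instance problems than the default (as in `TameHullDefs`)
set_option maxSynthPendingDepth 3
-- every `Summit.FinalStateConjecture.FinalStateConjecture.…` name repeats the summit segment (D-0017 layout)
set_option linter.dupNamespace false

open Set Filter Function TopologicalSpace Manifold Bundle
open scoped Topology Manifold ContDiff ENNReal NNReal

namespace Summit.FinalStateConjecture.FinalStateConjecture.Theorems.DarkFuture

open Literature.Geometry.Lorentzian
open Summit.FinalStateConjecture.FinalStateConjecture.Theorems.TameHull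

/-- The pullback identity of a local isometry of the smooth Kerr exterior
`(Kerr.exterior M a, Kerr.smoothMetric M a r₊)` into a spacetime `𝓢` is the vanishing of the
Kerr–Schild metric deviation `Ψ^* g − g_{M,a}` of `Spacetime.deviation (Kerr.background M a)`:
both sides are `g(dΨ ·, dΨ ·) = Kerr.bilin M a x` at every `x` (O'Neill 1983, Ch. 3, pp. 90–91,
local isometries; DHRT arXiv:2104.08222, §1, the deviation `g − g_{a,M}`). [cite: ONeill1983, Ch. 3, pp. 90–91] -/
theorem deviation_kerrBackground_eq_zero_of_isLocalIsometry {𝓢 : Spacetime.{0} 4} [Kerr.Facts]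
    (M a : ℝ) {Ψ : Kerr.exterior M a → 𝓢.carrier}
    (hΨ : PseudoRiemannianMetric.IsLocalIsometry
      (Kerr.smoothMetric M a (Kerr.rPlus M a)).toPseudoRiemannianMetric
      𝓢.metric.toPseudoRiemannianMetric Ψ)
    (x : Kerr.exterior M a) : 𝓢.deviation (Kerr.background M a) Ψ x = 0 := by
  rw [Spacetime.deviation, sub_eq_zero]
  exact hΨ.2 x

/-- **Glue G4 (line `dark-future-exactness`, N1 ⇐ eternal stationary exterior rigidity).** An
injective local isometry `Ψ` of the smooth Kerr exterior `(Kerr.exterior M a, Kerr.smoothMetric M a r₊)`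
(ingoing Kerr–Schild chart `{r > r₊}`) into `𝓢` with image `O`, whose push-forward of `∂_{t*}` is
future-directed outside the ergoregion `{r > 2M}` (the black-hole, not the white-hole, exterior),
exhibits `O` as a Kerr domain of outer communications `(M, a)` in the sense of `TameHull.IsKerrDoc`:
`Ψ` is `C^∞` as a local diffeomorphism, and `Ψ^* g = g_{M,a}` is the vanishing of the Kerr–Schild
deviation (`deviation_kerrBackground_eq_zero_of_isLocalIsometry`). O'Neill 1983, Ch. 3, pp. 90–91;
Dafermos–Luk 2017, Conjecture 1 (the Kerr exterior as the final state). [cite: ONeill1983, Ch. 3, pp. 90–91] -/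
theorem isKerrDoc_of_isLocalIsometry : ∀ {𝓢 : Spacetime.{0} 4} [Kerr.Facts] (O : Set 𝓢.carrier) (M a : ℝ) (Ψ : Kerr.exterior M a → 𝓢.carrier), Function.Injective Ψ → Set.range Ψ = O → PseudoRiemannianMetric.IsLocalIsometry (Kerr.smoothMetric M a (Kerr.rPlus M a)).toPseudoRiemannianMetric 𝓢.metric.toPseudoRiemannianMetric Ψ → (∀ x : Kerr.exterior M a, 2 * M < Kerr.radius a x.1 → 𝓢.timeOrientation.IsFutureDirected (mfderiv 𝓘(ℝ, E4) (𝓡 4) Ψ x (E4.basisVector 0))) → IsKerrDoc 𝓢 O M a := by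
  intro 𝓢 _ O M a Ψ hinj hrange hΨ hfut
  exact ⟨Ψ, hinj, hΨ.1.contMDiff, hrange,
    deviation_kerrBackground_eq_zero_of_isLocalIsometry M a hΨ, hfut⟩

end Summit.FinalStateConjecture.FinalStateConjecture.Theorems.DarkFuture

end
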